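import Summits.HodgeConjecture.HodgeConjecture.Theorems.F0P3LettersRouting   -- ★ p823358: the LETTER #82 `CohClassRouting`, `clFinChoice`, `cmSplitPacket`, `splitWitness`, V6 frame vocabulary
import HarnessLib

/-!
# `F0P3CohClassRoutingCot` — the GUARDED letter #82 texts `RoutesAt` ∕ `CohClassRoutingCot` ∕ `CohClassRoutingCotClosed`, LIFTED to `Theorems/` (R-32)

Cell `hodgecm-mathlib`, F0∕P3 «U3-mult», crux H413 (`stmt-HodgeConjecture-24833`); F0P3-p04 (g8), RULING (V61) (REF1 (g7) R-32).  DEF lane: three `def … : Prop`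
WITH BODIES (predicates with parameters — the routing conclusion at `(P, ξ, v)`, the guarded letter, its ∀-closure over the closer's frames) + one `theorem` (the unguarded
letter implies the guarded one); no instance, no notation, no `sorry`; `--supports stmt-HodgeConjecture-24833`.

The texts are LIFTED VERBATIM from the T2 pay-down line `Cruxes/H413/Lines/F0_T2_CohClassRoutingCotPaydown.lean` (ED. 5, typ-T2a (g0) ∕ F0P3b-plan; permission
RULING (V61)) — there they live in a `crux write`-editable workfile; the rung-0 closer `Lines/F0_U3LettersRung1.lean` types its registered stub `stub_L3` over
`CohClassRoutingCotClosed` since ED. 5, and REF1's R-32 asks that a REGISTERED stub's statement rest on a ★ Theorems text, not on a Lines text.  SEQUENCING ((V61)): this file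
lands FIRST under its own namespace; the T2 line's next edition imports it and DELETES its local copies (re-pointing `cohClassRoutingCot_closed` and its stubs at these names);
then the closer's ED. 7 re-types `stub_L3 : F0P3CohClassRoutingCot.CohClassRoutingCotClosed` (statement identical up to namespace).

WHAT THE TEXTS SAY [Rogawski1990 §15.3 ¶1 p. 244; Thm. 13.3.6 (c) p. 202; §13.1 p. 199; §12.2 (2) pp. 173–174; §14.2 pp. 232–234]: `RoutesAt P ξ v` — at a SPLIT `v` the chosen
local class `clFinChoice P v` is the member `πⁿ` of the ★ D6 split packet at the fixed witness, at a NON-SPLIT `v` it is Keys' non-`L²` label `(keys ξ v hns).πn` transported along every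
level-matching form congruence (VERBATIM the `∀ v ∉ S₁` body of ★ `CohClassRouting`); `CohClassRoutingCot` — for every discrete `P` of COTANGENT type (`IsCot`) carrying a degree-one
token, some one-dimensional automorphic `ξ` of `H` and a finite `S₁` with `RoutesAt P ξ v` off `S₁` (the routing [§15.3 ¶1] asserts for the cohomological `P` only — weaker than the
unguarded ★ `CohClassRouting`, `cohClassRoutingCot_of_cohClassRouting`); `CohClassRoutingCotClosed` — its ∀-closure over the letters' frames (`hdef h2 hμω`) and the rung-0 Haar ∕ Keys
data (Borel σ-algebras, `μZ v` Haar).  HONEST LABEL: HC_CM is proved only modulo the printed citations until rung 0 closes; this file asserts nothing (definitions + one implication).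
-/

set_option autoImplicit false
set_option linter.dupNamespace false

noncomputable section

open NumberField IsDedekindDomain MeasureTheory Filter
open Literature.NumberTheory.Rogawski1990 Literature.NumberTheory.GaloisRepresentations
open Literature.NumberTheory.Automorphic Literature.NumberTheory.Automorphic.UnitaryGroup
open Literature.NumberTheory.Automorphic.UnitaryGroup.CotangentForms
open Literature.RepresentationTheory.BorelWallach2000 Literature.RepresentationTheory.KonnoKonno2007
open scoped Matrix Classical ComplexOrder

namespace Summit.HodgeConjecture.HodgeConjecture.Cruxes.H413.F0P3CohClassRoutingCot

open Summit.HodgeConjecture.HodgeConjecture.Cruxes.H413.F0P3InnerFormClassificationV6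
open Summit.HodgeConjecture.HodgeConjecture.Cruxes.H413.F0P3ClassTokenChoice (clFinChoice admUnitConstituents)
open Summit.HodgeConjecture.HodgeConjecture.Cruxes.H413.F0P3LettersRouting (CohClassRouting)

-- Mathlib idiom (as in ★ `F0P3LettersRouting`): commutator bracket on `Module.End`, needed to MENTION `(uFormGroup (Fin 2) (Fin 1)).lie →ₗ⁅ℝ⁆ Module.End ℂ M`
attribute [local instance 100] LieRing.ofAssociativeRing

variable (L : Type) [Field L] [NumberField L] [IsCMField L] (H : Matrix (Fin 3) (Fin 3) L)
  (hH : (H.map (cmConjRingHom L))ᵀ = H) (hHd : IsUnit H.det) (μω : HeckeCharacter L) (hμu : μω.IsUnitary)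
  [∀ v : HeightOneSpectrum (𝓞 ↥(maximalRealSubfield L)), MeasurableSpace (Gqs L v ⧸ Subgroup.center (Gqs L v))]
  (μZ : ∀ v : HeightOneSpectrum (𝓞 ↥(maximalRealSubfield L)), Measure (Gqs L v ⧸ Subgroup.center (Gqs L v)))
  (keys : ∀ (ξ : OneDimAutRepH L) (v : HeightOneSpectrum (𝓞 ↥(maximalRealSubfield L))),
    (∀ w : PlacesOver L v, IsCMField.complexConj L • w.1 = w.1) →
      {p : IrrClass (Gqs L v) × IrrClass (Gqs L v) //
        KeysCaseTwoLabels L v (μω.semilocalComponent L v) (torusLocalComponent L (IsCMField.complexConj L) v ξ.η)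
          (torusLocalComponent L (IsCMField.complexConj L) v ξ.ψ) p.1 p.2 ∧
        p.1.IsSquareIntegrable (μZ v) ∧ ¬ p.2.IsSquareIntegrable (μZ v)})
  (ι : L →+* ℂ) (T : GL (Fin 3) ℂ)
  (hT : (T : Matrix (Fin 3) (Fin 3) ℂ)ᴴ * H.map ι * (T : Matrix (Fin 3) (Fin 3) ℂ) = Literature.Geometry.ComplexHyperbolic.BallModel.J)
  (μ : Measure (Gp L H).automorphicQuotient) [(Gp L H).IsAutomorphicMeasure μ]

/-! ## §0 The routing conclusion at `(P, ξ, v)` and the GUARDED letter (lifted from the T2 line, R-32) -/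

/-- **The routing conclusion of letter #82 at one place** — VERBATIM the `∀ v ∉ S₁` body of ★ `CohClassRouting` at `(P, ξ, v)`: at a SPLIT `v` the chosen local class of `P`
(★ `clFinChoice P v`) is the member `πⁿ` of the ★ D6 split packet at the fixed witness; at a NON-SPLIT `v` it is Keys' non-`L²` label `(keys ξ v hns).πn` transported along EVERY
level-matching form congruence. [cite: Rogawski1990, §15.3 ¶1; §13.1 p. 199; §12.2 (2) pp. 173–174] -/
def RoutesAt (P : DiscreteAutomorphicRep (Gp L H) μ) (ξ : OneDimAutRepH L) (v : Places L) : Prop :=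
  (∀ hs : ∃ w : PlacesOver L v, IsCMField.complexConj L • w.1 ≠ w.1,
      clFinChoice P v =
        (cmSplitPacket L H hH hHd v (splitWitness v hs) (splitWitness_spec v hs) (ξ.splitν₀ μω (splitWitness v hs).1)
          (ξ.locψ (splitWitness v hs).1) (ξ.norm_splitν₀_apply hμu (splitWitness v hs).1)
          (ξ.continuous_splitν₀ μω (splitWitness v hs).1) (ξ.norm_locψ_apply (splitWitness v hs).1)
          (ξ.continuous_locψ (splitWitness v hs).1)).πn) ∧
  (∀ hns : ∀ w : PlacesOver L v, IsCMField.complexConj L • w.1 = w.1,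
    ∀ (T : GL (Fin 3) (LocalRing L v)) (a : LocalRing L v) (ha : IsUnit a)
      (h : formCongr (conjLocal L (IsCMField.complexConj L) v) T (H.map (algebraMap L (LocalRing L v))) =
        a • (Matrix.of fun i j : Fin 3 => if i.val + j.val + 1 = 3 then (1 : L) else 0).map (algebraMap L (LocalRing L v))),
      (∀ g : (cmDatum L 3 H).Local v, (cmDatumLocalCongr L v T ha h).symm g ∈ cmLocalIntegralLevel L 3 (qsForm L) v ↔
        g ∈ cmLocalIntegralLevel L 3 H v) →
      clFinChoice P v = IrrClass.comap (cmDatumLocalCongr L v T ha h).symm (keys ξ v hns).1.2)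

/-- **The letter #82 GUARDED by cotangent type** — `∀ P, IsCot P → ‹CohClassRouting's body at P›` (★ `IsCot`: `P` is holomorphic- or antiholomorphic-cotangent at `ι` on the compact
datum; the kit law `Routing` only ever routes such `P`, V7∕V8).  Source: Rogawski 1990, §15.3 ¶1 and Thm. 13.3.6 (c) p. 202 (the `cite` tag is carried by
`cohClassRoutingCot_of_cohClassRouting` below — a closed-header `def` must not carry one in a Theorems file, D246). -/
def CohClassRoutingCot : Prop :=
  ∀ (P : DiscreteAutomorphicRep (Gp L H) μ), IsCot L H ι T hT μ P → ∀ (M : Type) [AddCommGroup M] [Module ℂ M]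
    (σK : Representation ℂ (uFormGroup (Fin 2) (Fin 1)).maximalCompact M) (σ𝔤 : (uFormGroup (Fin 2) (Fin 1)).lie →ₗ⁅ℝ⁆ Module.End ℂ M)
    (hM : IsGKModule (uFormGroup (Fin 2) (Fin 1)) σK σ𝔤), IsIrreducibleGK σK σ𝔤 → HasToken L H ι T hT μ P M σK σ𝔤 →
    ∀ δ : ℤ, (δ = 1 ∨ δ = -1) → upqTypeClasses σK σ𝔤 hM.ad_compat 1 δ ≠ ⊥ →
      ∃ (ξ : OneDimAutRepH L) (S₁ : Finset (Places L)), ∀ v : Places L, v ∉ S₁ → RoutesAt L H hH hHd μω hμu μZ keys μ P ξ v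

/-- Sanity: the letter implies its guarded form (the conclusion texts agree token for token). [cite: Rogawski1990, §15.3 ¶1] -/
theorem cohClassRoutingCot_of_cohClassRouting (h : CohClassRouting L H hH hHd μω hμu μZ keys ι T hT μ) :
    CohClassRoutingCot L H hH hHd μω hμu μZ keys ι T hT μ :=
  fun P _ M _ _ σK σ𝔤 hM hirr htok δ hδ hne => h P M σK σ𝔤 hM hirr htok δ hδ hne


/-! ## §1 The ∀-closure over the closer's frames (the text of the rung-0 closer's `stub_L3`) -/

/-- **The guarded letter over ALL closer frames** — the ∀-closure of `CohClassRoutingCot` under the letters' frame `hdef h2 hμω` and the rung-0 instances (Borel σ-algebras and Haar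
measures `μZ v` on `U(Φ₃)(L⁺_v) ⧸ Z`); this closed `Prop` is what a skeleton would be REGISTERED against (the closer's `stub_L3` since its ED. 5).  Source: Rogawski 1990,
§15.3 ¶1; §4.8 p. 51 (no `cite` tag on a closed-header `def`, D246). -/
def CohClassRoutingCotClosed : Prop :=
  ∀ (L : Type) [Field L] [NumberField L] [IsCMField L] (ι : L →+* ℂ) (H : Matrix (Fin 3) (Fin 3) L) (T : GL (Fin 3) ℂ)
    (hT : (T : Matrix (Fin 3) (Fin 3) ℂ)ᴴ * H.map ι * (T : Matrix (Fin 3) (Fin 3) ℂ) = Literature.Geometry.ComplexHyperbolic.BallModel.J)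
    (hH : (H.map (cmConjRingHom L))ᵀ = H) (hHd : IsUnit H.det),
    (∀ τ' : L →+* ℂ, InfinitePlace.mk τ' ≠ InfinitePlace.mk ι → (H.map τ').PosDef) → 2 ≤ Module.finrank ℚ ↥(maximalRealSubfield L) →
    ∀ (μ : Measure (Gp L H).automorphicQuotient) [(Gp L H).IsAutomorphicMeasure μ] (μω : HeckeCharacter L) (hμu : μω.IsUnitary),
    (∀ x : Literature.NumberTheory.GaloisRepresentations.ideleGroup ↥(maximalRealSubfield L), μω (AdeleRing.ideleBaseChange (↥(maximalRealSubfield L)) L x) = quadraticHeckeCharCM L x) →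
    ∀ [∀ v : HeightOneSpectrum (𝓞 ↥(maximalRealSubfield L)), MeasurableSpace (Gqs L v ⧸ Subgroup.center (Gqs L v))]
      [∀ v : HeightOneSpectrum (𝓞 ↥(maximalRealSubfield L)), BorelSpace (Gqs L v ⧸ Subgroup.center (Gqs L v))]
      (μZ : ∀ v : HeightOneSpectrum (𝓞 ↥(maximalRealSubfield L)), Measure (Gqs L v ⧸ Subgroup.center (Gqs L v)))
      [∀ v : HeightOneSpectrum (𝓞 ↥(maximalRealSubfield L)), (μZ v).IsHaarMeasure]
      (keys : ∀ (ξ : OneDimAutRepH L) (v : HeightOneSpectrum (𝓞 ↥(maximalRealSubfield L))),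
        (∀ w : PlacesOver L v, IsCMField.complexConj L • w.1 = w.1) →
          {p : IrrClass (Gqs L v) × IrrClass (Gqs L v) //
            KeysCaseTwoLabels L v (μω.semilocalComponent L v) (torusLocalComponent L (IsCMField.complexConj L) v ξ.η)
              (torusLocalComponent L (IsCMField.complexConj L) v ξ.ψ) p.1 p.2 ∧
            p.1.IsSquareIntegrable (μZ v) ∧ ¬ p.2.IsSquareIntegrable (μZ v)}),
    CohClassRoutingCot L H hH hHd μω hμu μZ keys ι T hT μ


end Summit.HodgeConjecture.HodgeConjecture.Cruxes.H413.F0P3CohClassRoutingCot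

end
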